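import Mathlib

/-!
# Crux `RtdLocal` (stmt-ResolutionOfSingularities-18840), line `Sketch` — stub `stub_sq_dominated`

Algebra input of the cotangent-invariance argument (Monreal, arXiv:2606.12554, the reason behind
Prop. 4.2, typed in the route's Hahn-series dress).

Setting: `A` a commutative `k`-algebra presented by a finite family `g : J → A` lying in an ideal
`n` (`Algebra.adjoin k (range g) = ⊤`), and two distinct "arcs centred at `n`"
`a ≠ b : A →ₐ[k] k⟦t^ℚ⟧`, i.e. `k`-algebra maps sending `n` to series of positive order
(`v := HahnSeries.orderTop`).

Claim: the least order `μ := min_j v (a (g j) - b (g j))` is attained at some `j`, and every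
`q ∈ n ^ 2` satisfies `μ < v (a q - b q)`.

Proof:
* some generator separates `a` and `b` (two algebra maps agreeing on generators of `⊤` agree),
  so `μ < ⊤`;
* nonnegativity `0 ≤ v (a x)` for all `x` and the Lipschitz bound `μ ≤ v (a x - b x)` for all
  `x`, both by `Algebra.adjoin_induction`, the multiplicative step resting on
  `a (x * y) - b (x * y) = a x * (a y - b y) + (a x - b x) * b y` and the ultrametric
  inequalities `min (v x) (v y) ≤ v (x + y)`, `v x + v y ≤ v (x * y)`;
* strictness on products `x * y` with `x, y ∈ n` (both summands above gain the positive order of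
  `a x`, resp. `b y`), extended to `n ^ 2 = n * n` by `Submodule.mul_induction_on`.
-/

-- single-problem summit: the doubled namespace component `ResolutionOfSingularities` is forced
set_option linter.dupNamespace false

namespace Summit.ResolutionOfSingularities.ResolutionOfSingularities.Theorems

section Helpers

variable {k : Type} [Field k] {A : Type} [CommRing A] [Algebra k A]

/-- Constants `algebraMap k k⟦t^ℚ⟧ r` have nonnegative order. -/
theorem sqdom_orderTop_algebraMap_nonneg (r : k) :
    0 ≤ (algebraMap k (HahnSeries ℚ k) r).orderTop := by
  -- (`import Mathlib` makes `algebraMap k k⟦t^ℚ⟧` factor through power series)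
  have hC : algebraMap k (HahnSeries ℚ k) r = HahnSeries.C r := by
    first
    | rfl
    | (rw [HahnSeries.algebraMap_apply']; simp)
  rw [hC, HahnSeries.C_apply]
  exact HahnSeries.orderTop_single_le

/-- A `k`-algebra map `A →ₐ[k] k⟦t^ℚ⟧` sending a generating family to series of nonnegative
order sends every element of `A` to a series of nonnegative order. -/
theorem sqdom_orderTop_nonneg {J : Type} (g : J → A)
    (hgen : Algebra.adjoin k (Set.range g) = ⊤) (a : A →ₐ[k] HahnSeries ℚ k)
    (ha : ∀ j, 0 ≤ (a (g j)).orderTop) (x : A) : 0 ≤ (a x).orderTop := by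
  have hx : x ∈ Algebra.adjoin k (Set.range g) := by
    rw [hgen]
    exact Algebra.mem_top
  induction hx using Algebra.adjoin_induction with
  | mem x hx =>
    obtain ⟨j, rfl⟩ := hx
    exact ha j
  | algebraMap r =>
    rw [AlgHom.commutes]
    exact sqdom_orderTop_algebraMap_nonneg r
  | add x y _ _ hx hy =>
    rw [map_add]
    exact (le_min hx hy).trans HahnSeries.min_orderTop_le_orderTop_add
  | mul x y _ _ hx hy =>
    rw [map_mul]
    exact (add_nonneg hx hy).trans HahnSeries.orderTop_add_le_mul

/-- Lipschitz bound: if two `k`-algebra maps `a b : A →ₐ[k] k⟦t^ℚ⟧` of nonnegative order on a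
generating family `g` differ by series of order `≥ μ` on `g`, then they differ by series of
order `≥ μ` everywhere. -/
theorem sqdom_le_orderTop_sub {J : Type} (g : J → A)
    (hgen : Algebra.adjoin k (Set.range g) = ⊤) (a b : A →ₐ[k] HahnSeries ℚ k)
    (ha : ∀ j, 0 ≤ (a (g j)).orderTop) (hb : ∀ j, 0 ≤ (b (g j)).orderTop)
    {μ : WithTop ℚ} (hμ : ∀ j, μ ≤ (a (g j) - b (g j)).orderTop) (x : A) :
    μ ≤ (a x - b x).orderTop := by
  have hx : x ∈ Algebra.adjoin k (Set.range g) := by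
    rw [hgen]
    exact Algebra.mem_top
  induction hx using Algebra.adjoin_induction with
  | mem x hx =>
    obtain ⟨j, rfl⟩ := hx
    exact hμ j
  | algebraMap r =>
    rw [AlgHom.commutes, AlgHom.commutes, sub_self, HahnSeries.orderTop_zero]
    exact le_top
  | add x y _ _ hx hy =>
    rw [map_add, map_add, add_sub_add_comm]
    exact (le_min hx hy).trans HahnSeries.min_orderTop_le_orderTop_add
  | mul x y _ _ hx hy =>
    have key : a (x * y) - b (x * y) = a x * (a y - b y) + (a x - b x) * b y := by
      rw [map_mul, map_mul]
      ring
    rw [key]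
    refine (le_min ?_ ?_).trans HahnSeries.min_orderTop_le_orderTop_add
    · calc μ = 0 + μ := (zero_add μ).symm
        _ ≤ (a x).orderTop + (a y - b y).orderTop :=
          add_le_add (sqdom_orderTop_nonneg g hgen a ha x) hy
        _ ≤ _ := HahnSeries.orderTop_add_le_mul
    · calc μ = μ + 0 := (add_zero μ).symm
        _ ≤ (a x - b x).orderTop + (b y).orderTop :=
          add_le_add hx (sqdom_orderTop_nonneg g hgen b hb y)
        _ ≤ _ := HahnSeries.orderTop_add_le_mul

/-- Strict product rule: in the situation of `sqdom_le_orderTop_sub` with `μ < ⊤`, on a product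
`x * y` with `a x` and `b y` of positive order the two maps differ by a series of order `> μ`. -/
theorem sqdom_lt_orderTop_sub_mul {J : Type} (g : J → A)
    (hgen : Algebra.adjoin k (Set.range g) = ⊤) (a b : A →ₐ[k] HahnSeries ℚ k)
    (ha : ∀ j, 0 ≤ (a (g j)).orderTop) (hb : ∀ j, 0 ≤ (b (g j)).orderTop)
    {μ : WithTop ℚ} (hμ : ∀ j, μ ≤ (a (g j) - b (g j)).orderTop) (hμtop : μ ≠ ⊤)
    {x y : A} (hax : 0 < (a x).orderTop) (hby : 0 < (b y).orderTop) :
    μ < (a (x * y) - b (x * y)).orderTop := by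
  have key : a (x * y) - b (x * y) = a x * (a y - b y) + (a x - b x) * b y := by
    rw [map_mul, map_mul]
    ring
  rw [key]
  refine (lt_min ?_ ?_).trans_le HahnSeries.min_orderTop_le_orderTop_add
  · calc μ = 0 + μ := (zero_add μ).symm
      _ < (a x).orderTop + (a y - b y).orderTop :=
        WithTop.add_lt_add_of_lt_of_le hμtop hax (sqdom_le_orderTop_sub g hgen a b ha hb hμ y)
      _ ≤ _ := HahnSeries.orderTop_add_le_mul
  · calc μ = μ + 0 := (add_zero μ).symm
      _ < (a x - b x).orderTop + (b y).orderTop :=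
        WithTop.add_lt_add_of_le_of_lt hμtop (sqdom_le_orderTop_sub g hgen a b ha hb hμ x) hby
      _ ≤ _ := HahnSeries.orderTop_add_le_mul

end Helpers

/-- **SQ-DOMINATED** (stub 4 of crux `RtdLocal`, typed reason of Monreal Prop. 4.2): for two
distinct arcs `a ≠ b : A →ₐ[k] k⟦t^ℚ⟧` centred at `n` (positive order on `n`) and a finite
presentation `g ⊆ n` of `A`, the least order `min_j v (a (g j) - b (g j))` is attained at some
`j` and is strictly exceeded by `v (a q - b q)` for every `q ∈ n ^ 2`. -/
theorem stub_sq_dominated {k : Type} [Field k] {A : Type} [CommRing A] [Algebra k A]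
    (n : Ideal A) {J : Type} [Fintype J] (g : J → A) (hg : ∀ j, g j ∈ n)
    (hgen : Algebra.adjoin k (Set.range g) = ⊤)
    (a b : A →ₐ[k] HahnSeries ℚ k) (ha : ∀ x ∈ n, 0 < (a x).orderTop)
    (hb : ∀ x ∈ n, 0 < (b x).orderTop) (hab : a ≠ b) :
    ∃ j, (∀ j', (a (g j) - b (g j)).orderTop ≤ (a (g j') - b (g j')).orderTop) ∧
      ∀ q ∈ n ^ 2, (a (g j) - b (g j)).orderTop < (a q - b q).orderTop := by
  -- Step 0: some generator separates `a` and `b`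
  obtain ⟨j₁, hj₁⟩ : ∃ j, a (g j) - b (g j) ≠ 0 := by
    by_contra h
    exact hab (AlgHom.ext_of_adjoin_eq_top hgen fun x hx => by
      obtain ⟨j, rfl⟩ := hx
      exact sub_eq_zero.mp (of_not_not (not_exists.mp h j)))
  -- Step 1: a generator of least order difference; the least order is finite
  obtain ⟨j₀, -, hj₀⟩ := Finset.exists_min_image Finset.univ
    (fun j => (a (g j) - b (g j)).orderTop) ⟨j₁, Finset.mem_univ _⟩
  have hmin : ∀ j', (a (g j₀) - b (g j₀)).orderTop ≤ (a (g j') - b (g j')).orderTop :=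
    fun j' => hj₀ j' (Finset.mem_univ _)
  have hμtop : (a (g j₀) - b (g j₀)).orderTop ≠ ⊤ :=
    ((hmin j₁).trans_lt (HahnSeries.orderTop_lt_top.mpr hj₁)).ne
  refine ⟨j₀, hmin, fun q hq => ?_⟩
  -- Steps 2–5: Lipschitz bound, strict product rule, additivity over `n ^ 2 = n * n`
  rw [pow_two] at hq
  refine Submodule.mul_induction_on hq (fun x hx y hy => ?_) (fun x y hx hy => ?_)
  · exact sqdom_lt_orderTop_sub_mul g hgen a b (fun j => (ha _ (hg j)).le)
      (fun j => (hb _ (hg j)).le) hmin hμtop (ha x hx) (hb y hy)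
  · rw [map_add, map_add, add_sub_add_comm]
    exact (lt_min hx hy).trans_le HahnSeries.min_orderTop_le_orderTop_add

end Summit.ResolutionOfSingularities.ResolutionOfSingularities.Theorems
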